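import Summits.QuantumFields.YangMills.Theorems.ColdStartUniversalityLatticeLangevinMartingaleCLT
import Summits.QuantumFields.YangMills.Theorems.ColdStartUniversalityLatticeLangevinDiscreteCorrector
import Summits.QuantumFields.YangMills.Theorems.ColdStartUniversalityLatticeLangevinDiscreteIncrements
import Summits.QuantumFields.YangMills.Theorems.ColdStartUniversalityLatticeLangevinDiscreteSampling
import Summits.QuantumFields.YangMills.Theorems.ColdStartUniversalityLatticeLangevinDynkinCellBounds
import HarnessLib

/-!
# Route `ColdStartUniversality` (fixed-cut-off SZZ dynamics, sampler package): ★★★ THE CENTRAL LIMIT THEOREM FOR DISCRETE SAMPLES OF THE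
# COLD-START LANGEVIN SAMPLER — `N^(−1/2) Σ_(k<N) (G(U_(kh)) − μ_(β')(G)) ⇒ N(0, σ_h²(G))` from EVERY deterministic start

Helper file (seat `ym-line-csu-p1`, g35; `--supports stmt-QuantumFields-24809`).  Files 54/71/75 gave the law of large numbers, Hoeffding's
inequality and the almost-sure rate for the empirical means `N⁻¹ Σ_(k<N) G(U_(kh))` of the `h`-skeleton of the SU(2) SZZ dynamics; file 67/89 the
asymptotic variance.  This file proves the GAUSSIAN FLUCTUATIONS: for every coupling `β'`, every realising Markov kernel family `κ`, EVERY strong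
solution `U` from a deterministic start `x` on ANY probability space, every bounded measurable `|G| ≤ 1`, every step `h > 0`, with
`Ĝ = G − μ_(β')(G)` and the DISCRETE GREEN–KUBO constant

  `σ_h²(G) = ∫ Ĝ² dμ_(β') + 2 Σ_(j≥1) ∫ Ĝ · κ_(jh) Ĝ dμ_(β')  ( = Σ_(j∈ℤ) Cov_μ(Ĝ(U_0), Ĝ(U_(jh))) ≥ 0 )`,

★★★ `discreteSampling_clt`: (i) `σ_h² ≥ 0`; (ii) for every real `θ`, `E exp(iθ N^(−1/2) Σ_(k<N) Ĝ(U_(kh))) → exp(−θ² σ_h²/2)`; (iii) for every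
random variable `Y` of law `gaussianReal 0 σ_h²` (any auxiliary space), `N^(−1/2) Σ_(k<N) Ĝ(U_(kh)) → Y` IN DISTRIBUTION (Mathlib's
`TendstoInDistribution`).  Proof (Gordin–Lifšic / Kipnis–Varadhan for a uniformly ergodic chain, from a NON-stationary start): the discrete Poisson
corrector `u` (file 93a) turns the sum into the martingale `Σ_(k<N) D_k` plus the boundary term `u(U_0) − u(U_(Nh)) = O(1)`; the increments are
orthogonal to the past with EXACT predictable variance `v(U_(kh))` (file 93b); the engine (files 92a–c) bounds the distance of the characteristic
function of `N^(−1/2) Σ D_k` to `exp(−θ²σ²/2)` by `O(N^(−1/2)) + (θ²/2)e^(…) E|N⁻¹ Σ_(k<N) v(U_(kh)) − σ²|`, and the mean-square ergodic theorem for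
discrete samples (file 54, applied to `v/b²`) makes the last term `O(N^(−1/2))`; Lévy's theorem concludes.  THEOREMS ONLY, no definition, no sorry;
[folklore] (Gordin–Lifšic 1978; Kipnis–Varadhan 1986; Meyn–Tweedie, Markov Chains and Stochastic Stability, Thm 17.0.1).  HONEST FRAMING: fixed
cut-off; `σ_h²` and the implicit constants depend on `L, β', h`; nothing is uniform in the cut-off; `UniformColdStartMixing` (24809) is NOT restated;
no crux, rung or summit statement is proved; the Yang–Mills mass gap is NOT proved.
-/

set_option autoImplicit false

noncomputable section

namespace Summit.QuantumFields.YangMills.Theorems.ColdStartUniversality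

open MeasureTheory ProbabilityTheory Filter Topology Set
open scoped NNReal ENNReal BigOperators
open Literature Literature.Probability.Process Literature.MathematicalPhysics.QuantumFieldTheory
open Literature.MathematicalPhysics.QuantumLattice (fundamentalRep fundamentalLatticeRep continuous_fundamentalRep)

variable {L : ℕ} [NeZero L]
set_option maxHeartbeats 400000 in
/-- ★★★ **CENTRAL LIMIT THEOREM FOR DISCRETE SAMPLES OF THE COLD-START SZZ SAMPLER** (every coupling, every start, every realisation, every
bounded measurable observable, every step `h > 0`).  With `Ĝ = G − μ_(β')G` and `σ² = ∫ Ĝ² dμ_(β') + 2 Σ'_j ∫ Ĝ · κ_((j+1)h)Ĝ dμ_(β')`: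
`0 ≤ σ²`; `E exp(iθ N^(−1/2) Σ_(k<N) Ĝ(U_(kh))) → exp(−θ²σ²/2)` for every real `θ`; and `N^(−1/2) Σ_(k<N) Ĝ(U_(kh)) → Y` in distribution
for every `Y ~ gaussianReal 0 σ²`. [folklore] -/
theorem discreteSampling_clt (L : ℕ) [NeZero L] (β' : ℝ)
    (κ : ℝ≥0 → Kernel (GaugeConfig 3 L (Matrix.specialUnitaryGroup (Fin 2) ℂ))
      (GaugeConfig 3 L (Matrix.specialUnitaryGroup (Fin 2) ℂ))) [∀ t, IsMarkovKernel (κ t)]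
    (hreal : ∀ (t : ℝ≥0) (x : GaugeConfig 3 L (Matrix.specialUnitaryGroup (Fin 2) ℂ))
        (Ω : Type) [MeasurableSpace Ω] (P : Measure Ω) [IsProbabilityMeasure P]
        (W : ℝ≥0 → Ω → (Edge 3 L × NoiseIdx 2 → ℝ)) (hW : IsFlatBrownian W P)
        (U : ℝ≥0 → Ω → GaugeConfig 3 L (Matrix.specialUnitaryGroup (Fin 2) ℂ)),
        (∀ ω, U 0 ω = x) →
        (latticeLangevinDynamics (fundamentalLatticeRep 2) β').IsSolution (fundamentalRep (Fin 2))
          hW.natFiltration P W U →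
        κ t x = P.map (U t))
    (x : GaugeConfig 3 L (Matrix.specialUnitaryGroup (Fin 2) ℂ))
    {Ω : Type} [MeasurableSpace Ω] {P : Measure Ω} [IsProbabilityMeasure P]
    {W : ℝ≥0 → Ω → (Edge 3 L × NoiseIdx 2 → ℝ)} (hW : IsFlatBrownian W P)
    {U : ℝ≥0 → Ω → GaugeConfig 3 L (Matrix.specialUnitaryGroup (Fin 2) ℂ)} (hU0 : ∀ ω, U 0 ω = x)
    (hU : (latticeLangevinDynamics (fundamentalLatticeRep 2) β').IsSolution (fundamentalRep (Fin 2)) hW.natFiltration P W U)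
    {G : GaugeConfig 3 L (Matrix.specialUnitaryGroup (Fin 2) ℂ) → ℝ} (hG : Measurable G) (hG1 : ∀ z, |G z| ≤ 1)
    {h : ℝ≥0} (hh : 0 < h) {σ2 : ℝ}
    (hσ2 : σ2 = (∫ y, (G y - ∫ z, G z ∂(wilsonMeasure (d := 3) (L := L) (fundamentalRep (Fin 2)) β')) ^ 2
        ∂(wilsonMeasure (d := 3) (L := L) (fundamentalRep (Fin 2)) β')) +
      2 * ∑' j : ℕ, ∫ y, (G y - ∫ z, G z ∂(wilsonMeasure (d := 3) (L := L) (fundamentalRep (Fin 2)) β')) *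
        (∫ z, (G z - ∫ z', G z' ∂(wilsonMeasure (d := 3) (L := L) (fundamentalRep (Fin 2)) β')) ∂(κ (((j + 1 : ℕ) : ℝ≥0) * h) y))
        ∂(wilsonMeasure (d := 3) (L := L) (fundamentalRep (Fin 2)) β')) :
    0 ≤ σ2 ∧
    (∀ θ : ℝ, Tendsto (fun N : ℕ => ∫ ω, Complex.exp (((θ * ((Real.sqrt N)⁻¹ * ∑ k ∈ Finset.range N,
        (G (U ((k : ℝ≥0) * h) ω) - ∫ z, G z ∂(wilsonMeasure (d := 3) (L := L) (fundamentalRep (Fin 2)) β'))) : ℝ) : ℂ) * Complex.I) ∂P)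
      atTop (𝓝 (Complex.exp (-((θ ^ 2 * σ2 / 2 : ℝ) : ℂ))))) ∧
    ∀ (Ω' : Type) [MeasurableSpace Ω'] (P' : Measure Ω') [IsProbabilityMeasure P'] (Y : Ω' → ℝ),
      HasLaw Y (gaussianReal 0 σ2.toNNReal) P' →
      TendstoInDistribution (fun (N : ℕ) ω => (Real.sqrt N)⁻¹ * ∑ k ∈ Finset.range N,
        (G (U ((k : ℝ≥0) * h) ω) - ∫ z, G z ∂(wilsonMeasure (d := 3) (L := L) (fundamentalRep (Fin 2)) β'))) atTop Y (fun _ => P) P' := by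
  classical
  haveI := secondCountableTopology_su2
  haveI := borelSpace_config L
  set μ : Measure (GaugeConfig 3 L (Matrix.specialUnitaryGroup (Fin 2) ℂ)) :=
    wilsonMeasure (d := 3) (L := L) (fundamentalRep (Fin 2)) β' with hμ
  haveI : IsProbabilityMeasure μ :=
    isProbabilityMeasure_wilsonMeasure (d := 3) (L := L) (fundamentalRep (Fin 2)) (continuous_fundamentalRep (Fin 2)) β'
  set m : ℝ := ∫ z, G z ∂μ with hm
  have hm1 : |m| ≤ 1 := by
    have hh' := norm_integral_le_of_norm_le_const (μ := μ) (f := G) (C := 1)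
      (Eventually.of_forall fun z => by simpa [Real.norm_eq_abs] using hG1 z)
    simpa [Real.norm_eq_abs] using hh'
  set Gh : GaugeConfig 3 L (Matrix.specialUnitaryGroup (Fin 2) ℂ) → ℝ := fun z => G z - m with hGh
  have hGhm : Measurable Gh := hG.sub measurable_const
  have hmU : ∀ s : ℝ≥0, Measurable (U s) := fun s => (hU.adapted s).mono (hW.natFiltration.le s) le_rfl
  /- ### 1. Corrector, increments, variance proxy -/
  obtain ⟨C, c, hC, hc, hcorr⟩ := exists_discreteCorrector L β'
  obtain ⟨u, hum, hub, hPois, hv0, hvb, hGK⟩ := hcorr κ hreal G hG hG1 h hh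
  set b : ℝ := C / (1 - Real.exp (-c * h)) with hb
  have hρ1 : Real.exp (-c * h) < 1 := Real.exp_lt_one_iff.2 (by have : (0 : ℝ) < h := hh; nlinarith)
  have hb0 : 0 < b := div_pos hC (by linarith)
  obtain ⟨D, v, hDdef, hvdef, hDF, hvF, hDb, horth, hvar⟩ := exists_discreteIncrements β' κ hreal hum hub x hW hU0 hU h
  set vf : GaugeConfig 3 L (Matrix.specialUnitaryGroup (Fin 2) ℂ) → ℝ := fun y =>
    (∫ z, u z ^ 2 ∂(κ h y)) - (∫ z, u z ∂(κ h y)) ^ 2 with hvf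
  have hvfm : Measurable vf :=
    (((hum.pow_const 2).stronglyMeasurable.integral_kernel (κ := κ h)).measurable).sub
      (((hum.stronglyMeasurable.integral_kernel (κ := κ h)).measurable).pow_const 2)
  have hσ : σ2 = ∫ y, vf y ∂μ := by rw [hσ2]; exact hGK.symm
  have hσ0 : 0 ≤ σ2 := by rw [hσ]; exact integral_nonneg fun y => hv0 y
  have hσb : σ2 ≤ b ^ 2 := by
    rw [hσ]
    calc ∫ y, vf y ∂μ ≤ ∫ y, b ^ 2 ∂μ := integral_mono_of_nonneg (Eventually.of_forall hv0) (integrable_const _) (Eventually.of_forall hvb)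
      _ = b ^ 2 := by simp
  have hDm : ∀ k, Measurable (D k) := fun k => (hDF k).mono (hW.natFiltration.le _) le_rfl
  have hvm : ∀ k, Measurable (v k) := fun k => (hvF k).mono (hW.natFiltration.le _) le_rfl
  have hvk0 : ∀ k ω, 0 ≤ v k ω := fun k ω => by rw [hvdef]; exact hv0 _
  have hvkb : ∀ k ω, v k ω ≤ b ^ 2 := fun k ω => by rw [hvdef]; exact hvb _
  -- telescoping: `Σ_(k<N) D_k = u(U_(Nh)) − u(x) + Σ_(k<N) Ĝ(U_(kh))`
  have htel : ∀ N ω, ∑ k ∈ Finset.range N, D k ω =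
      u (U ((N : ℝ≥0) * h) ω) - u x + ∑ k ∈ Finset.range N, Gh (U ((k : ℝ≥0) * h) ω) := by
    intro N ω
    have h1 : ∀ k, D k ω = (u (U (((k + 1 : ℕ) : ℝ≥0) * h) ω) - u (U ((k : ℝ≥0) * h) ω)) + Gh (U ((k : ℝ≥0) * h) ω) := fun k => by
      rw [hDdef, hPois]; simp only [hGh]; ring
    rw [Finset.sum_congr rfl fun k _ => h1 k, Finset.sum_add_distrib,
      Finset.sum_range_sub (fun k => u (U ((k : ℝ≥0) * h) ω)) N, Nat.cast_zero, zero_mul, hU0 ω]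
  /- ### 2. Mean-square ergodic theorem for the proxies (file 54 applied to `v/b²`) -/
  obtain ⟨C₂, c₂, hC₂, hc₂, h54⟩ := integral_sq_average_sub_wilson_le L β'
  set c54 : ℝ := 4 + 4 * C₂ * Real.exp (-c₂ * h) / (1 - Real.exp (-c₂ * h)) with hc54
  have hρ2 : Real.exp (-c₂ * h) < 1 := Real.exp_lt_one_iff.2 (by have : (0 : ℝ) < h := hh; nlinarith)
  have hc54_0 : 0 ≤ c54 := by
    have : 0 ≤ 4 * C₂ * Real.exp (-c₂ * h) / (1 - Real.exp (-c₂ * h)) := div_nonneg (by positivity) (by linarith)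
    simp only [hc54]; linarith
  set gf : GaugeConfig 3 L (Matrix.specialUnitaryGroup (Fin 2) ℂ) → ℝ := fun y => vf y / b ^ 2 with hgf
  have hgfm : Measurable gf := hvfm.div_const _
  have hgf1 : ∀ y, |gf y| ≤ 1 := fun y => by
    simp only [hgf]; rw [abs_div, abs_of_nonneg (hv0 y), abs_of_pos (by positivity : (0 : ℝ) < b ^ 2), div_le_one (by positivity)]
    exact hvb y
  have hgfμ : ∫ y, gf y ∂μ = σ2 / b ^ 2 := by simp only [hgf]; rw [integral_div, ← hσ]
  have hL1 : ∀ N : ℕ, 1 ≤ N →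
      ∫ ω, |(∑ j ∈ Finset.range N, (N : ℝ)⁻¹ * v j ω) - σ2| ∂P ≤ b ^ 2 * Real.sqrt c54 * (Real.sqrt N)⁻¹ := by
    intro N hN
    have hNr : (0 : ℝ) < N := by exact_mod_cast hN
    have h1 := h54 x Ω P W hW U hU0 hU gf hgfm hgf1 h hh N hN
    rw [hgfμ] at h1
    -- `Σ N⁻¹ v_j − σ² = b² · (N⁻¹ Σ gf(U_jh) − σ²/b²)`
    have heq : ∀ ω, (∑ j ∈ Finset.range N, (N : ℝ)⁻¹ * v j ω) - σ2 =
        b ^ 2 * ((N : ℝ)⁻¹ * (∑ k ∈ Finset.range N, gf (U ((k : ℝ≥0) * h) ω)) - σ2 / b ^ 2) := fun ω => by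
      have hb2 : (b ^ 2 : ℝ) ≠ 0 := by positivity
      have h1 : ∑ k ∈ Finset.range N, gf (U ((k : ℝ≥0) * h) ω) = (∑ k ∈ Finset.range N, vf (U ((k : ℝ≥0) * h) ω)) / b ^ 2 := by
        rw [Finset.sum_div]
      have h2 : ∑ j ∈ Finset.range N, (N : ℝ)⁻¹ * v j ω = (N : ℝ)⁻¹ * ∑ j ∈ Finset.range N, vf (U ((j : ℝ≥0) * h) ω) := by
        rw [Finset.mul_sum]; exact Finset.sum_congr rfl fun j _ => by rw [hvdef]
      rw [h1, h2]
      generalize (∑ k ∈ Finset.range N, vf (U ((k : ℝ≥0) * h) ω)) = S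
      field_simp
    have hXm : Measurable fun ω => (N : ℝ)⁻¹ * (∑ k ∈ Finset.range N, gf (U ((k : ℝ≥0) * h) ω)) - σ2 / b ^ 2 :=
      ((Finset.measurable_sum _ fun k _ => hgfm.comp (hmU _)).const_mul _).sub measurable_const
    have hXb : ∀ ω, |(N : ℝ)⁻¹ * (∑ k ∈ Finset.range N, gf (U ((k : ℝ≥0) * h) ω)) - σ2 / b ^ 2| ≤ 2 := fun ω => by
      refine (abs_sub _ _).trans ?_
      have h2 : |(N : ℝ)⁻¹ * ∑ k ∈ Finset.range N, gf (U ((k : ℝ≥0) * h) ω)| ≤ 1 := by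
        rw [abs_mul, abs_inv, abs_of_pos hNr]
        have h3 : |∑ k ∈ Finset.range N, gf (U ((k : ℝ≥0) * h) ω)| ≤ N := (Finset.abs_sum_le_sum_abs _ _).trans (by
          calc ∑ k ∈ Finset.range N, |gf (U ((k : ℝ≥0) * h) ω)| ≤ ∑ _k ∈ Finset.range N, (1 : ℝ) := Finset.sum_le_sum fun k _ => hgf1 _
            _ = N := by simp)
        calc (N : ℝ)⁻¹ * |∑ k ∈ Finset.range N, gf (U ((k : ℝ≥0) * h) ω)| ≤ (N : ℝ)⁻¹ * N := mul_le_mul_of_nonneg_left h3 (inv_nonneg.2 hNr.le)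
          _ = 1 := inv_mul_cancel₀ hNr.ne'
      have h4 : |σ2 / b ^ 2| ≤ 1 := by
        rw [abs_div, abs_of_nonneg hσ0, abs_of_pos (by positivity : (0 : ℝ) < b ^ 2), div_le_one (by positivity)]; exact hσb
      linarith
    have hJ := integral_abs_le_sqrt_integral_sq (P := P)
      (MemLp.of_bound hXm.aestronglyMeasurable 2 (ae_of_all _ fun ω => by rw [Real.norm_eq_abs]; exact hXb ω))
    rw [integral_congr_ae (ae_of_all _ fun ω => show |(∑ j ∈ Finset.range N, (N : ℝ)⁻¹ * v j ω) - σ2| =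
        b ^ 2 * |(N : ℝ)⁻¹ * (∑ k ∈ Finset.range N, gf (U ((k : ℝ≥0) * h) ω)) - σ2 / b ^ 2| by
        rw [heq, abs_mul, abs_of_pos (by positivity : (0 : ℝ) < b ^ 2)]), integral_const_mul, mul_assoc]
    refine mul_le_mul_of_nonneg_left (hJ.trans ?_) (by positivity)
    calc Real.sqrt (∫ ω, ((N : ℝ)⁻¹ * (∑ k ∈ Finset.range N, gf (U ((k : ℝ≥0) * h) ω)) - σ2 / b ^ 2) ^ 2 ∂P)
        ≤ Real.sqrt (c54 / N) := Real.sqrt_le_sqrt h1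
      _ = Real.sqrt c54 * (Real.sqrt N)⁻¹ := by rw [Real.sqrt_div hc54_0, div_eq_mul_inv]
  /- ### 3. The engine at sample size `N ≥ 1` -/
  set K₁ : ℝ → ℝ := fun θ => Real.exp (θ ^ 2 * b ^ 2 / 2) *
    (2 * |θ| ^ 3 * Real.exp (|θ| * (2 * b)) * b ^ 3 + θ ^ 4 * b ^ 4 / 4 + (|θ| * (2 * b) + θ ^ 2 * (2 * b) ^ 2 / 2) * (θ ^ 2 * b ^ 2 / 2))
    with hK₁
  set K₂ : ℝ → ℝ := fun θ => θ ^ 2 / 2 * Real.exp (max (θ ^ 2 * b ^ 2 / 2) (θ ^ 2 * σ2 / 2)) * (b ^ 2 * Real.sqrt c54) with hK₂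
  have hkey : ∀ (θ : ℝ) (N : ℕ), 1 ≤ N →
      ‖(∫ ω, Complex.exp (((θ * ∑ j ∈ Finset.range N, (Real.sqrt N)⁻¹ * D j ω : ℝ) : ℂ) * Complex.I) ∂P) -
          Complex.exp (-((θ ^ 2 * σ2 / 2 : ℝ) : ℂ))‖ ≤ (K₁ θ + K₂ θ) * (Real.sqrt N)⁻¹ := by
    intro θ N hN
    have hNr : (0 : ℝ) < N := by exact_mod_cast hN
    set t : ℝ := (Real.sqrt N)⁻¹ with ht
    have hsN : 0 < Real.sqrt N := Real.sqrt_pos.2 hNr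
    have ht0 : 0 < t := inv_pos.2 hsN
    have ht1 : t ≤ 1 := by
      rw [ht, inv_le_one₀ hsN]
      exact Real.one_le_sqrt.2 (by exact_mod_cast hN)
    have ht2 : t ^ 2 = (N : ℝ)⁻¹ := by rw [ht, inv_pow, Real.sq_sqrt hNr.le]
    have hNt2 : (N : ℝ) * t ^ 2 = 1 := by rw [ht2, mul_inv_cancel₀ hNr.ne']
    -- scaled increments and proxies
    set D' : ℕ → Ω → ℝ := fun k ω => t * D k ω with hD'
    set v' : ℕ → Ω → ℝ := fun k ω => t ^ 2 * v k ω with hv'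
    have hD'm : ∀ k, Measurable (D' k) := fun k => (hDm k).const_mul t
    have hv'm : ∀ k, Measurable (v' k) := fun k => (hvm k).const_mul _
    have hD'b : ∀ k ω, |D' k ω| ≤ t * (2 * b) := fun k ω => by
      simp only [hD']; rw [abs_mul, abs_of_pos ht0]; exact mul_le_mul_of_nonneg_left (hDb k ω) ht0.le
    have hv'0 : ∀ k ω, 0 ≤ v' k ω := fun k ω => mul_nonneg (sq_nonneg _) (hvk0 k ω)
    have hv'b : ∀ k ω, v' k ω ≤ t ^ 2 * b ^ 2 := fun k ω => mul_le_mul_of_nonneg_left (hvkb k ω) (sq_nonneg _)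
    have hkh : ∀ j k : ℕ, j ≤ k → (j : ℝ≥0) * h ≤ (k : ℝ≥0) * h := fun j k hjk => mul_le_mul_of_nonneg_right (by exact_mod_cast hjk) h.2
    have hSF : ∀ k : ℕ, Measurable[hW.natFiltration ((k : ℝ≥0) * h)] fun ω => ∑ j ∈ Finset.range k, D' j ω := fun k =>
      Finset.measurable_sum _ fun j hj =>
        ((hDF j).mono (hW.natFiltration.mono (hkh (j + 1) k (Nat.succ_le_of_lt (Finset.mem_range.1 hj)))) le_rfl).const_mul t
    have hVF : ∀ k : ℕ, Measurable[hW.natFiltration ((k : ℝ≥0) * h)] fun ω => ∑ j ∈ Finset.range k, v' j ω := fun k =>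
      Finset.measurable_sum _ fun j hj =>
        ((hvF j).mono (hW.natFiltration.mono (hkh j k (Finset.mem_range.1 hj).le)) le_rfl).const_mul _
    have horth' : ∀ k < N, ∀ Z : Ω → ℝ, Measurable[hW.natFiltration ((k : ℝ≥0) * h)] Z → (∀ ω, 0 ≤ Z ω) →
        (∃ CZ : ℝ, ∀ ω, Z ω ≤ CZ) → ∫ ω, Z ω * D' k ω ∂P = 0 := fun k _ Z hZ hZ0 hZb => by
      have h1 := horth k Z hZ hZ0 hZb
      simp only [hD']
      rw [integral_congr_ae (ae_of_all _ fun ω => show Z ω * (t * D k ω) = t * (Z ω * D k ω) by ring), integral_const_mul, h1,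
        mul_zero]
    have hvar' : ∀ k < N, ∀ Z : Ω → ℝ, Measurable[hW.natFiltration ((k : ℝ≥0) * h)] Z → (∀ ω, 0 ≤ Z ω) →
        (∃ CZ : ℝ, ∀ ω, Z ω ≤ CZ) → |∫ ω, Z ω * (D' k ω ^ 2 - v' k ω) ∂P| ≤ 0 * ∫ ω, Z ω ∂P := fun k _ Z hZ hZ0 hZb => by
      have h1 := hvar k Z hZ hZ0 hZb
      simp only [hD', hv']
      rw [integral_congr_ae (ae_of_all _ fun ω => show Z ω * ((t * D k ω) ^ 2 - t ^ 2 * v k ω) = t ^ 2 * (Z ω * (D k ω ^ 2 - v k ω)) by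
        ring), integral_const_mul, h1, mul_zero, abs_zero, zero_mul]
    have hE := norm_integral_cexp_sum_sub_gaussian_le (fun k : ℕ => hW.natFiltration ((k : ℝ≥0) * h))
      (fun k => hW.natFiltration.le _) D' v' hD'm hv'm (by positivity : (0 : ℝ) ≤ t * (2 * b)) (by positivity : (0 : ℝ) ≤ t ^ 2 * b ^ 2)
      le_rfl hD'b hv'0 hv'b hSF hVF N horth' hvar' hσ0 θ
    -- simplify the engine bound with `N t² = 1`, `t ≤ 1`
    have hNA : (N : ℝ) * (θ ^ 2 * (t ^ 2 * b ^ 2) / 2) = θ ^ 2 * b ^ 2 / 2 := by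
      rw [show (N : ℝ) * (θ ^ 2 * (t ^ 2 * b ^ 2) / 2) = (N * t ^ 2) * (θ ^ 2 * b ^ 2 / 2) by ring, hNt2, one_mul]
    rw [hNA] at hE
    have hV' : ∫ ω, |(∑ j ∈ Finset.range N, v' j ω) - σ2| ∂P ≤ b ^ 2 * Real.sqrt c54 * t := by
      have h1 := hL1 N hN
      simp only [hv']; rw [ht2]; exact h1
    have hexpB : Real.exp (|θ| * (t * (2 * b))) ≤ Real.exp (|θ| * (2 * b)) :=
      Real.exp_le_exp.2 (mul_le_mul_of_nonneg_left (mul_le_of_le_one_left (by positivity) ht1) (abs_nonneg θ))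
    have ht2le : t ^ 2 ≤ t := by nlinarith
    have hP1 : (N : ℝ) * (|θ| ^ 3 * Real.exp (|θ| * (t * (2 * b))) * (t * (2 * b)) * (t ^ 2 * b ^ 2 + 0)) ≤
        (2 * |θ| ^ 3 * Real.exp (|θ| * (2 * b)) * b ^ 3) * t := by
      have hre : (N : ℝ) * (|θ| ^ 3 * Real.exp (|θ| * (t * (2 * b))) * (t * (2 * b)) * (t ^ 2 * b ^ 2 + 0)) =
          (2 * |θ| ^ 3 * Real.exp (|θ| * (t * (2 * b))) * b ^ 3) * t * ((N : ℝ) * t ^ 2) := by ring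
      rw [hre, hNt2, mul_one]
      refine mul_le_mul_of_nonneg_right ?_ ht0.le
      exact mul_le_mul_of_nonneg_right (mul_le_mul_of_nonneg_left hexpB (by positivity)) (by positivity)
    have hP2 : (N : ℝ) * (θ ^ 2 * (t ^ 2 * b ^ 2) / 2) ^ 2 ≤ (θ ^ 4 * b ^ 4 / 4) * t := by
      have hre : (N : ℝ) * (θ ^ 2 * (t ^ 2 * b ^ 2) / 2) ^ 2 = (θ ^ 4 * b ^ 4 / 4) * t ^ 2 * ((N : ℝ) * t ^ 2) := by ring
      rw [hre, hNt2, mul_one]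
      exact mul_le_mul_of_nonneg_left ht2le (by positivity)
    have hP3 : (N : ℝ) * ((|θ| * (t * (2 * b)) + θ ^ 2 * (t * (2 * b)) ^ 2 / 2) * (θ ^ 2 * (t ^ 2 * b ^ 2) / 2)) ≤
        ((|θ| * (2 * b) + θ ^ 2 * (2 * b) ^ 2 / 2) * (θ ^ 2 * b ^ 2 / 2)) * t := by
      have hre : (N : ℝ) * ((|θ| * (t * (2 * b)) + θ ^ 2 * (t * (2 * b)) ^ 2 / 2) * (θ ^ 2 * (t ^ 2 * b ^ 2) / 2)) =
          ((|θ| * (2 * b)) * t + (θ ^ 2 * (2 * b) ^ 2 / 2) * t ^ 2) * (θ ^ 2 * b ^ 2 / 2) * ((N : ℝ) * t ^ 2) := by ring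
      rw [hre, hNt2, mul_one]
      have hx : (|θ| * (2 * b)) * t + (θ ^ 2 * (2 * b) ^ 2 / 2) * t ^ 2 ≤ (|θ| * (2 * b) + θ ^ 2 * (2 * b) ^ 2 / 2) * t := by
        rw [add_mul]; exact add_le_add le_rfl (mul_le_mul_of_nonneg_left ht2le (by positivity))
      calc ((|θ| * (2 * b)) * t + (θ ^ 2 * (2 * b) ^ 2 / 2) * t ^ 2) * (θ ^ 2 * b ^ 2 / 2)
          ≤ ((|θ| * (2 * b) + θ ^ 2 * (2 * b) ^ 2 / 2) * t) * (θ ^ 2 * b ^ 2 / 2) := mul_le_mul_of_nonneg_right hx (by positivity)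
        _ = ((|θ| * (2 * b) + θ ^ 2 * (2 * b) ^ 2 / 2) * (θ ^ 2 * b ^ 2 / 2)) * t := by ring
    have hρ' : (N : ℝ) * Real.exp (θ ^ 2 * b ^ 2 / 2) *
        (θ ^ 2 * 0 + |θ| ^ 3 * Real.exp (|θ| * (t * (2 * b))) * (t * (2 * b)) * (t ^ 2 * b ^ 2 + 0) +
          (θ ^ 2 * (t ^ 2 * b ^ 2) / 2) ^ 2 + (|θ| * (t * (2 * b)) + θ ^ 2 * (t * (2 * b)) ^ 2 / 2) * (θ ^ 2 * (t ^ 2 * b ^ 2) / 2)) ≤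
        K₁ θ * t := by
      have hre : (N : ℝ) * Real.exp (θ ^ 2 * b ^ 2 / 2) *
          (θ ^ 2 * 0 + |θ| ^ 3 * Real.exp (|θ| * (t * (2 * b))) * (t * (2 * b)) * (t ^ 2 * b ^ 2 + 0) +
            (θ ^ 2 * (t ^ 2 * b ^ 2) / 2) ^ 2 + (|θ| * (t * (2 * b)) + θ ^ 2 * (t * (2 * b)) ^ 2 / 2) * (θ ^ 2 * (t ^ 2 * b ^ 2) / 2)) =
          Real.exp (θ ^ 2 * b ^ 2 / 2) *
            ((N : ℝ) * (|θ| ^ 3 * Real.exp (|θ| * (t * (2 * b))) * (t * (2 * b)) * (t ^ 2 * b ^ 2 + 0)) +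
              (N : ℝ) * (θ ^ 2 * (t ^ 2 * b ^ 2) / 2) ^ 2 +
              (N : ℝ) * ((|θ| * (t * (2 * b)) + θ ^ 2 * (t * (2 * b)) ^ 2 / 2) * (θ ^ 2 * (t ^ 2 * b ^ 2) / 2))) := by ring
      have hK : K₁ θ * t = Real.exp (θ ^ 2 * b ^ 2 / 2) * ((2 * |θ| ^ 3 * Real.exp (|θ| * (2 * b)) * b ^ 3) * t +
          (θ ^ 4 * b ^ 4 / 4) * t + ((|θ| * (2 * b) + θ ^ 2 * (2 * b) ^ 2 / 2) * (θ ^ 2 * b ^ 2 / 2)) * t) := by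
        simp only [hK₁]; ring
      rw [hre, hK]
      exact mul_le_mul_of_nonneg_left (add_le_add (add_le_add hP1 hP2) hP3) (Real.exp_pos _).le
    calc ‖(∫ ω, Complex.exp (((θ * ∑ j ∈ Finset.range N, (Real.sqrt N)⁻¹ * D j ω : ℝ) : ℂ) * Complex.I) ∂P) -
          Complex.exp (-((θ ^ 2 * σ2 / 2 : ℝ) : ℂ))‖
        ≤ (N : ℝ) * Real.exp (θ ^ 2 * b ^ 2 / 2) *
          (θ ^ 2 * 0 + |θ| ^ 3 * Real.exp (|θ| * (t * (2 * b))) * (t * (2 * b)) * (t ^ 2 * b ^ 2 + 0) +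
            (θ ^ 2 * (t ^ 2 * b ^ 2) / 2) ^ 2 + (|θ| * (t * (2 * b)) + θ ^ 2 * (t * (2 * b)) ^ 2 / 2) * (θ ^ 2 * (t ^ 2 * b ^ 2) / 2)) +
          θ ^ 2 / 2 * Real.exp (max (θ ^ 2 * b ^ 2 / 2) (θ ^ 2 * σ2 / 2)) * ∫ ω, |(∑ j ∈ Finset.range N, v' j ω) - σ2| ∂P := hE
      _ ≤ K₁ θ * t + θ ^ 2 / 2 * Real.exp (max (θ ^ 2 * b ^ 2 / 2) (θ ^ 2 * σ2 / 2)) * (b ^ 2 * Real.sqrt c54 * t) :=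
          add_le_add hρ' (mul_le_mul_of_nonneg_left hV' (by positivity))
      _ = (K₁ θ + K₂ θ) * t := by simp only [hK₂]; ring
  /- ### 4. Characteristic functions of the statistic -/
  have hTm : ∀ N : ℕ, Measurable fun ω => (Real.sqrt N)⁻¹ * ∑ k ∈ Finset.range N, Gh (U ((k : ℝ≥0) * h) ω) := fun N =>
    (Finset.measurable_sum _ fun k _ => hGhm.comp (hmU _)).const_mul _
  have hSm : ∀ N : ℕ, Measurable fun ω => ∑ j ∈ Finset.range N, (Real.sqrt N)⁻¹ * D j ω := fun N =>
    Finset.measurable_sum _ fun j _ => (hDm j).const_mul _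
  have hdiff : ∀ (N : ℕ) ω, |(∑ j ∈ Finset.range N, (Real.sqrt N)⁻¹ * D j ω) -
      (Real.sqrt N)⁻¹ * ∑ k ∈ Finset.range N, Gh (U ((k : ℝ≥0) * h) ω)| ≤ (Real.sqrt N)⁻¹ * (2 * b) := fun N ω => by
    rw [← Finset.mul_sum, htel N ω, ← mul_sub, show u (U ((N : ℝ≥0) * h) ω) - u x + ∑ k ∈ Finset.range N, Gh (U ((k : ℝ≥0) * h) ω) -
      ∑ k ∈ Finset.range N, Gh (U ((k : ℝ≥0) * h) ω) = u (U ((N : ℝ≥0) * h) ω) - u x by ring, abs_mul,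
      abs_of_nonneg (inv_nonneg.2 (Real.sqrt_nonneg _))]
    refine mul_le_mul_of_nonneg_left ((abs_sub _ _).trans ?_) (inv_nonneg.2 (Real.sqrt_nonneg _))
    linarith [hub (U ((N : ℝ≥0) * h) ω), hub x]
  have ht_tend : Tendsto (fun N : ℕ => (Real.sqrt N)⁻¹) atTop (𝓝 0) :=
    tendsto_inv_atTop_zero.comp (Real.tendsto_sqrt_atTop.comp tendsto_natCast_atTop_atTop)
  have hchar : ∀ θ : ℝ, Tendsto (fun N : ℕ => ∫ ω, Complex.exp (((θ * ((Real.sqrt N)⁻¹ * ∑ k ∈ Finset.range N,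
      Gh (U ((k : ℝ≥0) * h) ω)) : ℝ) : ℂ) * Complex.I) ∂P) atTop (𝓝 (Complex.exp (-((θ ^ 2 * σ2 / 2 : ℝ) : ℂ)))) := by
    intro θ
    refine tendsto_iff_norm_sub_tendsto_zero.2 (squeeze_zero_norm' ?_ ((ht_tend.const_mul (|θ| * (2 * b) + (K₁ θ + K₂ θ))).trans_eq
      (by simp)))
    filter_upwards [eventually_ge_atTop 1] with N hN
    rw [norm_norm]
    have h1 := norm_integral_cexp_sub_integral_cexp_le (P := P) (hSm N) (hTm N) (hdiff N) θ
    have h2 := hkey θ N hN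
    calc ‖(∫ ω, Complex.exp (((θ * ((Real.sqrt N)⁻¹ * ∑ k ∈ Finset.range N, Gh (U ((k : ℝ≥0) * h) ω)) : ℝ) : ℂ) * Complex.I) ∂P) -
          Complex.exp (-((θ ^ 2 * σ2 / 2 : ℝ) : ℂ))‖
        ≤ ‖(∫ ω, Complex.exp (((θ * ((Real.sqrt N)⁻¹ * ∑ k ∈ Finset.range N, Gh (U ((k : ℝ≥0) * h) ω)) : ℝ) : ℂ) * Complex.I) ∂P) -
            ∫ ω, Complex.exp (((θ * ∑ j ∈ Finset.range N, (Real.sqrt N)⁻¹ * D j ω : ℝ) : ℂ) * Complex.I) ∂P‖ +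
          ‖(∫ ω, Complex.exp (((θ * ∑ j ∈ Finset.range N, (Real.sqrt N)⁻¹ * D j ω : ℝ) : ℂ) * Complex.I) ∂P) -
            Complex.exp (-((θ ^ 2 * σ2 / 2 : ℝ) : ℂ))‖ := norm_sub_le_norm_sub_add_norm_sub _ _ _
      _ ≤ |θ| * ((Real.sqrt N)⁻¹ * (2 * b)) + (K₁ θ + K₂ θ) * (Real.sqrt N)⁻¹ := by
          refine add_le_add ?_ h2
          rw [norm_sub_rev]; exact h1
      _ = (|θ| * (2 * b) + (K₁ θ + K₂ θ)) * (Real.sqrt N)⁻¹ := by ring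
  refine ⟨hσ0, hchar, fun Ω' _ P' _ Y hY => ?_⟩
  exact tendstoInDistribution_of_tendsto_charFun_gaussian hTm hσ0 hchar hY

end Summit.QuantumFields.YangMills.Theorems.ColdStartUniversality

end
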